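import Literature.AlgebraicGeometry.HodgeTheory.ComplexOrientationFamily
import Literature.AlgebraicGeometry.Motives.ComplexPointsEhresmann
import Literature.AlgebraicGeometry.Resolution.ResolutionOfSingularities
import Literature.AlgebraicTopology.SingularHomology.PositiveAtlasOrientationNaturality
import Literature.AlgebraicTopology.SingularHomology.IntToCoeffClassNaturality
import Literature.Analysis.Complex.InjectiveHolomorphic
import Literature.NumberTheory.Transcendental.AnalytificationFunctorialityProofs
import HarnessLib

/-!
# A birational morphism of smooth projective complex varieties has degree `+1` for the COMPLEX
# orientations

Family `hodge`, layer `Literature/AlgebraicGeometry/HodgeTheory`. W. Fulton, *Intersection Theory*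
(1998), Lemma 19.1.2 with `deg(X'/X) = 1` (§1.4): `σ_* cl(X') = cl(X)` for a birational morphism
`σ : X' → X`; J. Milnor, J. Stasheff, *Characteristic Classes* (1974), §13 p. 151: holomorphic maps
preserve the preferred orientation of complex manifolds. The tree's
`HodgeTheory/BirationalMorphismDegree` proves `σ(ℂ)_* [X'(ℂ)]_μ = [X(ℂ)]_ν` for SOME orientations
("the value of the degree for the COMPLEX orientations of both sides (it is `1`; here the target
orientation is chosen)" is listed there as not done). With the complex orientations now defined
(`complexOrientationInt`, `HodgeTheory/ComplexOrientationFamily`: the orientation of the positive atlas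
of holomorphic algebraic charts) this file proves the degree is `+1` for THEM:

* `differentiableOn_algebraicChart_map` — **a morphism read in holomorphic algebraic charts is
  holomorphic** (its coordinates are pulled-back regular functions, `AlgPoints.evalOrZero_map`,
  holomorphic in the chart by Serre's GAGA §2 n°5 Prop. 2, `Motives.ComplexPoints.algebraicChart_spec`,
  after restriction to an affine open, `AlgPoints.evalOrZero_map_homOfLE`);
* `hasDegree_one_complexOrientationInt_of_isBirational` — **`σ(ℂ)_* [X'(ℂ)] = [X(ℂ)]` for the
  complex `ℤ`-orientations** of the closed `2n`-manifolds, `σ : X' ⟶ X` a birational morphism of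
  smooth projective `n`-folds: over the dense open `U ⊆ X` where `σ` is an isomorphism, `σ(ℂ)` is an
  open embedding near a complex point `w` which is the whole fibre through it (as in
  `BirationalMorphismDegree`); read in the algebraic charts at `w` and `σ w` it is an injective
  holomorphic map, so its complex Jacobian is invertible (Osgood, the tree's
  `SCV.bijective_fderiv_of_injOn`) and its real Jacobian has determinant `|det_ℂ|² > 0`; hence
  `σ(ℂ)_*` carries the local orientation class at `w` to the one at `σ w`
  (`positiveAtlasOrientation_map_localClass`), and a map of closed manifolds with one such good fibre
  has degree `1` (`hasDegree_one_of_map_localClass_eq`, Hatcher Thm. 3.26).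

Everything is proved; no definitions, no named facts. This is the case `k = 1`, for the integral
complex orientations, of the degree formula `Fulton1998_degreeFormula_complexOrientation`
(`HodgeTheory/ComplexOrientationCycleClassFacts`).

## References

* [Fulton1998] W. Fulton, Intersection Theory, 2nd ed., Springer 1998, §1.4 and Lemma 19.1.2.
* [MilnorStasheff1974] J. Milnor, J. Stasheff, Characteristic Classes, PUP 1974, §13 p. 151.
* [HatcherAT2002] A. Hatcher, Algebraic Topology, CUP 2002, §3.3 Thm. 3.26, p. 233.
* [SerreGAGA1956] J.-P. Serre, GAGA, Ann. Inst. Fourier 6 (1956), §2 n°5 Prop. 2.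
* [SGA1] A. Grothendieck, M. Raynaud, SGA 1, Exp. XII Prop. 3.1 (xi).
-/

noncomputable section

open scoped ContDiff Topology
open CategoryTheory AlgebraicGeometry Set Filter
open Literature.AlgebraicTopology.SingularHomology Literature.Topology.FourManifolds

namespace Literature.AlgebraicGeometry.HodgeTheory

section HodgeTheory

open Literature.AlgebraicGeometry.Motives

variable {m n : ℕ} {X' X : Motives.SchemeOver ℂ}

/-! ### Morphisms read in algebraic charts are holomorphic -/

/-- **A morphism read in holomorphic algebraic charts is holomorphic.** For `σ : X' ⟶ X` a
`ℂ`-morphism of schemes smooth of relative dimensions `m`, `n` and locally of finite type, a complex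
point `w` of `X'`, and the algebraic charts `a'` at `w`, `a` at `σ w`, the map
`v ↦ a (σ(ℂ) (a'⁻¹ v))` is `ℂ`-differentiable on the open set `a'.target ∩ a'⁻¹(σ(ℂ)⁻¹ a.source)`:
its coordinates are the regular coordinate functions of `a` pulled back along `σ`
(`AlgPoints.evalOrZero_map`), which are regular functions on `σ⁻¹U`, holomorphic in the chart `a'`
after restriction to affine opens (`algebraicChart_spec`, `AlgPoints.evalOrZero_map_homOfLE`) — Serre:
«si `f : X → Y` est une application régulière … `f` est aussi une application holomorphe de `X^h`
dans `Y^h`». [cite: SerreGAGA1956, §2 n°5 Prop. 2] -/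
theorem differentiableOn_algebraicChart_map [LocallyOfFiniteType X'.hom]
    [SmoothOfRelativeDimension m X'.hom] [LocallyOfFiniteType X.hom] [SmoothOfRelativeDimension n X.hom]
    (σ : X' ⟶ X) (w : ComplexPoints X') :
    DifferentiableOn ℂ
      (fun v ↦ ComplexPoints.algebraicChart X n (AlgPoints.map σ w)
        (AlgPoints.map σ ((ComplexPoints.algebraicChart X' m w).symm v)))
      ((ComplexPoints.algebraicChart X' m w).target ∩ (ComplexPoints.algebraicChart X' m w).symm ⁻¹'
        ((AlgPoints.map σ) ⁻¹' (ComplexPoints.algebraicChart X n (AlgPoints.map σ w)).source)) := by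
  set a' := ComplexPoints.algebraicChart X' m w with ha'
  set a := ComplexPoints.algebraicChart X n (AlgPoints.map σ w) with ha
  set O := a'.target ∩ a'.symm ⁻¹' ((AlgPoints.map σ) ⁻¹' a.source) with hO
  have hσc : Continuous (AlgPoints.map σ : ComplexPoints X' → ComplexPoints X) :=
    (AlgPoints.mapContinuous (L := ℂ) σ).continuous
  have hOo : IsOpen O := a'.isOpen_inter_preimage_symm (a.open_source.preimage hσc)
  obtain ⟨⟨U, x, hsrc, hx⟩, -⟩ := ComplexPoints.algebraicChart_spec X n (AlgPoints.map σ w)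
  obtain ⟨-, hol'⟩ := ComplexPoints.algebraicChart_spec X' m w
  intro v₀ hv₀
  refine DifferentiableAt.differentiableWithinAt ?_
  refine differentiableAt_pi.2 fun i ↦ ?_
  -- an affine open `V ⊆ σ⁻¹U` through the point `a'⁻¹ v₀`
  have hpt : (a'.symm v₀).pt ∈ σ.left ⁻¹ᵁ (U : X.left.Opens) := by
    change (AlgPoints.map σ (a'.symm v₀)).pt ∈ (U : X.left.Opens)
    exact hsrc hv₀.2
  obtain ⟨V, hVaff, hmV, hVU⟩ := exists_isAffineOpen_mem_and_subset (X := X'.left)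
    (U := σ.left ⁻¹ᵁ (U : X.left.Opens)) hpt
  have hVU' : V ≤ σ.left ⁻¹ᵁ (U : X.left.Opens) := hVU
  -- the neighbourhood `O' = O ∩ a'⁻¹ V(ℂ)` of `v₀`
  set O' := O ∩ a'.symm ⁻¹' {Q : ComplexPoints X' | Q.pt ∈ V} with hO'
  have hO'o : IsOpen O' := by
    rw [hO', hO, inter_assoc, ← preimage_inter]
    exact a'.isOpen_inter_preimage_symm ((a.open_source.preimage hσc).inter
      (AlgPoints.isOpen_setOf_pt_mem V))
  have hv₀' : v₀ ∈ O' := ⟨hv₀, hmV⟩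
  -- on `O'` the `i`-th coordinate is a regular function on the affine `V`, read in the chart `a'`
  set s : Γ(X'.left, V) := X'.left.presheaf.map (homOfLE hVU').op (σ.left.app (U : X.left.Opens) (x i))
    with hs
  have heq : (fun v ↦ a (AlgPoints.map σ (a'.symm v)) i) =ᶠ[𝓝 v₀]
      (AlgPoints.evalOrZero V s ∘ a'.symm) := by
    filter_upwards [hO'o.mem_nhds hv₀'] with v hv
    rw [Function.comp_apply, hx _ hv.1.2 i, AlgPoints.evalOrZero_map σ (U : X.left.Opens) (x i) (a'.symm v),
      hs,
      AlgPoints.evalOrZero_map_homOfLE hVU' _ hv.2]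
  refine DifferentiableAt.congr_of_eventuallyEq ?_ heq
  have hol := hol' ⟨V, hVaff⟩ s
  have hmem : v₀ ∈ a'.target ∩ a'.symm ⁻¹' {Q : ComplexPoints X' | Q.pt ∈ (↑(⟨V, hVaff⟩ :
      X'.left.affineOpens) : X'.left.Opens)} := ⟨hv₀.1, hmV⟩
  exact (hol.differentiableOn (by simp)).differentiableAt
    ((a'.isOpen_inter_preimage_symm (AlgPoints.isOpen_setOf_pt_mem _)).mem_nhds hmem)

/-! ### Degree `+1` of a birational morphism for the complex orientations -/

/-- **A birational morphism of smooth projective complex `n`-folds has degree `+1` for the complex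
orientations**: `σ(ℂ)_* [X'(ℂ)] = [X(ℂ)]` in `H_{2n}(X(ℂ); ℤ)` for the complex `ℤ`-orientations
`complexOrientationInt` of both sides (Fulton, Lemma 19.1.2 with `deg(X'/X) = 1`; Milnor–Stasheff §13:
holomorphic local isomorphisms preserve the complex orientation). Proof: over the dense open `U ⊆ X`
on which `σ` is an isomorphism, `σ(ℂ)` restricted to `σ⁻¹U(ℂ)` is the open embedding
`σ⁻¹U(ℂ) ≅ U(ℂ) ↪ X(ℂ)` and a complex point `w ∈ σ⁻¹U(ℂ)` is the whole fibre through it; read in the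
holomorphic algebraic charts at `w` and `σ w`, `σ(ℂ)` is holomorphic
(`differentiableOn_algebraicChart_map`) and injective near `w`, so its complex Jacobian is invertible
(`SCV.bijective_fderiv_of_injOn`) and the real one has determinant `|det_ℂ|² > 0`; therefore
`σ(ℂ)_* μ'_w = μ_{σ w}` for the positive-atlas orientations (`positiveAtlasOrientation_map_localClass`)
and the degree is `1` (`hasDegree_one_of_map_localClass_eq`). [cite: Fulton1998, Lemma 19.1.2 and §1.4]
[cite: MilnorStasheff1974, §13 p. 151] [cite: HatcherAT2002, §3.3 Thm. 3.26] -/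
theorem exists_map_localClass_complexOrientationInt_eq_of_isBirational
    (hX' : IsSmoothProjective n X') (hX : IsSmoothProjective n X) (σ : X' ⟶ X)
    (hσ : Resolution.IsBirational σ.left) :
    ∃ (P : ComplexPoints X') (hfib : MapsTo (AlgPoints.mapContinuous (L := ℂ) σ)
      ({P}ᶜ : Set (ComplexPoints X')) ({AlgPoints.mapContinuous (L := ℂ) σ P}ᶜ : Set (ComplexPoints X))),
      relativeSingularHomology.map ℤ ℤ (AlgPoints.mapContinuous (L := ℂ) σ) hfib (2 * n)
          ((complexOrientationInt hX').localClass P) =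
        (complexOrientationInt hX).localClass (AlgPoints.mapContinuous (L := ℂ) σ P) := by
  letI := hX.chartedSpace
  letI := hX'.chartedSpace
  haveI := ComplexPoints.compactSpace_of_isSmoothProjective hX
  haveI := ComplexPoints.compactSpace_of_isSmoothProjective hX'
  haveI := ComplexPoints.t2Space_of_isSmoothProjective hX
  haveI := ComplexPoints.t2Space_of_isSmoothProjective hX'
  haveI := connectedSpace_complexPoints hX
  haveI : IsProper X'.hom := IsSmoothProjective.isProper_holds hX'
  haveI : IsProper X.hom := IsSmoothProjective.isProper_holds hX
  haveI := hX'.smoothOfRelativeDimension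
  haveI := hX.smoothOfRelativeDimension
  haveI := hX'.geometricallyIrreducible
  haveI : IrreducibleSpace X'.left := GeometricallyIrreducible.irreducibleSpace_of_subsingleton X'.hom
  obtain ⟨U, -, hU', hiso⟩ := hσ
  -- the open pieces `V = σ⁻¹U ⊆ X'` and `U ⊆ X`; `σ ∘ (V ↪ X') = (V ≅ U ↪ X)`
  set V : X'.left.Opens := σ.left ⁻¹ᵁ U with hV
  set j : openSubschemeOver X' V ⟶ X' := openSubschemeOverι X' V with hj
  set g : openSubschemeOver X' V ⟶ X := restrictOverHom σ U ≫ openSubschemeOverι X U with hg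
  haveI : IsOpenImmersion j.left := inferInstanceAs (IsOpenImmersion V.ι)
  haveI : IsIso (σ.left ∣_ U) := hiso
  haveI : IsOpenImmersion (σ.left ∣_ U) := inferInstance
  haveI : IsOpenImmersion g.left := by
    change IsOpenImmersion ((σ.left ∣_ U) ≫ U.ι)
    infer_instance
  have hjg : j ≫ σ = g := (restrictOverHom_comp_openSubschemeOverι σ U).symm
  set f : C(ComplexPoints X', ComplexPoints X) := AlgPoints.mapContinuous (L := ℂ) σ with hf
  set jC : C(ComplexPoints (openSubschemeOver X' V), ComplexPoints X') :=
    AlgPoints.mapContinuous (L := ℂ) j with hjC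
  have hje : Topology.IsOpenEmbedding jC := AlgPoints.isOpenEmbedding_map_holds j
  have hcomp : f.comp jC = AlgPoints.mapContinuous (L := ℂ) g := by
    ext1 P
    change AlgPoints.map σ (AlgPoints.map j P) = AlgPoints.map g P
    rw [← AlgPoints.map_comp_apply, hjg]
  have hge : Topology.IsOpenEmbedding (f.comp jC) := by
    rw [hcomp]
    exact AlgPoints.isOpenEmbedding_map_holds g
  -- a complex point `w` of `V`
  have hVne : ((V : Set X'.left)).Nonempty := hU'.nonempty
  obtain ⟨P, hP⟩ := ComplexPoints.exists_pt_mem hVne V.2.isLocallyClosed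
  obtain ⟨w, hw⟩ : P ∈ Set.range (AlgPoints.map j : ComplexPoints (openSubschemeOver X' V) →
      ComplexPoints X') := by
    rw [AlgPoints.range_map_of_isOpenImmersion_holds j]
    change P.pt ∈ V.ι.opensRange
    rwa [Scheme.Opens.opensRange_ι]
  haveI : Nonempty (ComplexPoints (openSubschemeOver X' V)) := ⟨w⟩
  -- `σ(ℂ)` is injective on `range jC`, and the fibre of `σ(ℂ)` through `jC w` is `{jC w}`
  have hinjR : Set.InjOn f (Set.range jC) := by
    rintro _ ⟨w₁, rfl⟩ _ ⟨w₂, rfl⟩ h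
    exact congrArg jC (hge.injective h)
  have hfib : MapsTo f ({jC w}ᶜ : Set (ComplexPoints X')) ({f (jC w)}ᶜ : Set (ComplexPoints X)) := by
    intro Q hQ hQ'
    apply hQ
    rw [Set.mem_singleton_iff] at hQ' ⊢
    have hQV : Q.pt ∈ V := by
      have h := congrArg AlgPoints.pt hQ'
      change σ.left.base Q.pt = σ.left.base (AlgPoints.map j w).pt at h
      change σ.left.base Q.pt ∈ U
      rw [h, AlgPoints.pt_map]
      change (j.left ≫ σ.left).base w.pt ∈ U
      rw [← Over.comp_left, hjg]
      exact ((σ.left ∣_ U).base w.pt).2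
    obtain ⟨w', rfl⟩ : Q ∈ Set.range (AlgPoints.map j : ComplexPoints (openSubschemeOver X' V) →
        ComplexPoints X') := by
      rw [AlgPoints.range_map_of_isOpenImmersion_holds j]
      change Q.pt ∈ V.ι.opensRange
      rwa [Scheme.Opens.opensRange_ι]
    exact hinjR ⟨w', rfl⟩ ⟨w, rfl⟩ hQ'
  -- the open partial homeomorphism with total function `σ(ℂ)`
  set eg := hge.toOpenPartialHomeomorph (f.comp jC) with heg
  let e : OpenPartialHomeomorph (ComplexPoints X') (ComplexPoints X) :=
    { toFun := f
      invFun := fun Q ↦ jC (eg.symm Q)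
      source := Set.range jC
      target := Set.range (f.comp jC)
      map_source' := by rintro _ ⟨w', rfl⟩; exact ⟨w', rfl⟩
      map_target' := by rintro _ ⟨w', rfl⟩; exact ⟨_, rfl⟩
      left_inv' := by
        rintro _ ⟨w', rfl⟩
        change jC (eg.symm ((f.comp jC) w')) = jC w'
        rw [heg, hge.toOpenPartialHomeomorph_left_inv]
      right_inv' := by
        rintro _ ⟨w', rfl⟩
        rw [heg, hge.toOpenPartialHomeomorph_left_inv]
        rfl
      open_source := hje.isOpen_range
      open_target := hge.isOpen_range
      continuousOn_toFun := f.continuous.continuousOn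
      continuousOn_invFun := by
        refine (jC.continuous.comp_continuousOn eg.continuousOn_symm).mono ?_
        rw [heg, hge.toOpenPartialHomeomorph_target] }
  have hP₀ : jC w ∈ e.source := ⟨w, rfl⟩
  -- the written-out map in the algebraic charts: holomorphic, injective near the point
  set a' := ComplexPoints.algebraicChart X' n (jC w) with ha'
  set a := ComplexPoints.algebraicChart X n (f (jC w)) with ha
  set L := complexToEuclideanCLE n with hL
  set T : (Fin n → ℂ) → (Fin n → ℂ) := fun u ↦ a (f (a'.symm u)) with hT
  set O : Set (Fin n → ℂ) := a'.target ∩ a'.symm ⁻¹' (f ⁻¹' a.source ∩ Set.range jC) with hO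
  have hOo : IsOpen O :=
    a'.isOpen_inter_preimage_symm ((a.open_source.preimage f.continuous).inter hje.isOpen_range)
  have hsrc' : jC w ∈ a'.source := ComplexPoints.mem_algebraicChart_source X' n (jC w)
  have hsrc : f (jC w) ∈ a.source := ComplexPoints.mem_algebraicChart_source X n (f (jC w))
  have hp : a' (jC w) ∈ O := by
    refine ⟨a'.map_source hsrc', ?_⟩
    rw [mem_preimage, a'.left_inv hsrc']
    exact ⟨hsrc, ⟨w, rfl⟩⟩
  have hTdiff : DifferentiableOn ℂ T O :=
    (differentiableOn_algebraicChart_map σ (jC w)).mono fun u hu ↦ ⟨hu.1, hu.2.1⟩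
  have hTinj : Set.InjOn T O := by
    intro u₁ hu₁ u₂ hu₂ h
    have h1 : f (a'.symm u₁) = f (a'.symm u₂) := a.injOn hu₁.2.1 hu₂.2.1 h
    have h2 : a'.symm u₁ = a'.symm u₂ := hinjR hu₁.2.2 hu₂.2.2 h1
    exact a'.symm.injOn hu₁.1 hu₂.1 h2
  have hbij := Literature.Analysis.Complex.SCV.bijective_fderiv_of_injOn rfl hTdiff hOo hTinj hp
  set Aℂ : (Fin n → ℂ) →L[ℂ] (Fin n → ℂ) := fderiv ℂ T (a' (jC w)) with hAℂ
  have HT : HasFDerivAt T Aℂ (a' (jC w)) := (hTdiff.differentiableAt (hOo.mem_nhds hp)).hasFDerivAt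
  have hdetℂ : LinearMap.det (Aℂ : (Fin n → ℂ) →ₗ[ℂ] (Fin n → ℂ)) ≠ 0 := by
    have hbij' : Function.Bijective (Aℂ : (Fin n → ℂ) →ₗ[ℂ] (Fin n → ℂ)) := hbij
    have hu := (LinearEquiv.ofBijective (Aℂ : (Fin n → ℂ) →ₗ[ℂ] (Fin n → ℂ)) hbij').isUnit_det'
    have hcoe : ((LinearEquiv.ofBijective (Aℂ : (Fin n → ℂ) →ₗ[ℂ] (Fin n → ℂ)) hbij' :
        (Fin n → ℂ) ≃ₗ[ℂ] (Fin n → ℂ)) : (Fin n → ℂ) →ₗ[ℂ] (Fin n → ℂ)) =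
        (Aℂ : (Fin n → ℂ) →ₗ[ℂ] (Fin n → ℂ)) := LinearMap.ext fun _ ↦ rfl
    rw [hcoe] at hu
    exact hu.ne_zero
  -- the real Jacobian `L ∘ Aℂ ∘ L⁻¹` of `σ(ℂ)` read in the real charts, of determinant `|det Aℂ|² > 0`
  set A : EuclideanSpace ℝ (Fin (2 * n)) →L[ℝ] EuclideanSpace ℝ (Fin (2 * n)) :=
    (L : (Fin n → ℂ) →L[ℝ] _).comp ((Aℂ.restrictScalars ℝ).comp (L.symm : _ →L[ℝ] (Fin n → ℂ)))
    with hA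
  have hA' : HasFDerivAt (fun v ↦ chartAt (EuclideanSpace ℝ (Fin (2 * n))) (e (jC w))
      (e ((chartAt (EuclideanSpace ℝ (Fin (2 * n))) (jC w)).symm v))) A
      (chartAt (EuclideanSpace ℝ (Fin (2 * n))) (jC w) (jC w)) := by
    have hreal : (fun v ↦ chartAt (EuclideanSpace ℝ (Fin (2 * n))) (e (jC w))
        (e ((chartAt (EuclideanSpace ℝ (Fin (2 * n))) (jC w)).symm v))) = fun v ↦ L (T (L.symm v)) := by
      funext v
      rfl
    have hpt : chartAt (EuclideanSpace ℝ (Fin (2 * n))) (jC w) (jC w) = L (a' (jC w)) := rfl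
    rw [hreal, hpt]
    have h1 : HasFDerivAt (fun x ↦ L.symm x) (L.symm : _ →L[ℝ] (Fin n → ℂ)) (L (a' (jC w))) :=
      L.symm.hasFDerivAt
    have h2 : HasFDerivAt T (Aℂ.restrictScalars ℝ) (L.symm (L (a' (jC w)))) := by
      rw [L.symm_apply_apply]
      exact HT.restrictScalars ℝ
    have h3 : HasFDerivAt (fun u ↦ L u) (L : (Fin n → ℂ) →L[ℝ] _) (T (L.symm (L (a' (jC w))))) :=
      L.hasFDerivAt
    exact h3.comp (L (a' (jC w))) (h2.comp (L (a' (jC w))) h1)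
  have hdet : 0 < LinearMap.det (A : EuclideanSpace ℝ (Fin (2 * n)) →ₗ[ℝ] EuclideanSpace ℝ (Fin (2 * n))) := by
    rw [hA, det_conj_continuousLinearEquiv]
    have hrs : ((Aℂ.restrictScalars ℝ : (Fin n → ℂ) →L[ℝ] (Fin n → ℂ)) : (Fin n → ℂ) →ₗ[ℝ] (Fin n → ℂ)) =
        (Aℂ : (Fin n → ℂ) →ₗ[ℂ] (Fin n → ℂ)).restrictScalars ℝ := rfl
    rw [hrs, det_restrictScalars_eq_normSq]
    exact Complex.normSq_pos.2 hdetℂ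
  -- `σ(ℂ)_*` carries the local orientation class at `jC w` to the one at `σ (jC w)`; degree one
  have hloc := positiveAtlasOrientation_map_localClass (isPositiveAtlas_complexPoints hX')
    (isPositiveAtlas_complexPoints hX) (euclideanGenerator (2 * n)) e f.continuous hP₀ hfib hA' hdet
  exact ⟨jC w, hfib, hloc⟩

/-- **A birational morphism of smooth projective complex `n`-folds has degree `+1` for the complex
orientations**: `σ(ℂ)_* [X'(ℂ)] = [X(ℂ)]` in `H_{2n}(X(ℂ); ℤ)` for the complex `ℤ`-orientations
`complexOrientationInt` of both sides (Fulton, Lemma 19.1.2 with `deg(X'/X) = 1`): one good fibre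
(`exists_map_localClass_complexOrientationInt_eq_of_isBirational`) and
`hasDegree_one_of_map_localClass_eq` (Hatcher Thm. 3.26). [cite: Fulton1998, Lemma 19.1.2 and §1.4]
[cite: MilnorStasheff1974, §13 p. 151] [cite: HatcherAT2002, §3.3 Thm. 3.26] -/
theorem hasDegree_one_complexOrientationInt_of_isBirational (hX' : IsSmoothProjective n X')
    (hX : IsSmoothProjective n X) (σ : X' ⟶ X) (hσ : Resolution.IsBirational σ.left) :
    HasDegree (complexOrientationInt hX') (complexOrientationInt hX)
      (AlgPoints.mapContinuous (L := ℂ) σ) 1 := by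
  letI := hX.chartedSpace
  letI := hX'.chartedSpace
  haveI := ComplexPoints.compactSpace_of_isSmoothProjective hX
  haveI := ComplexPoints.compactSpace_of_isSmoothProjective hX'
  haveI := ComplexPoints.t2Space_of_isSmoothProjective hX
  haveI := ComplexPoints.t2Space_of_isSmoothProjective hX'
  haveI := connectedSpace_complexPoints hX
  obtain ⟨P, hfib, hloc⟩ := exists_map_localClass_complexOrientationInt_eq_of_isBirational hX' hX σ hσ
  exact hasDegree_one_of_map_localClass_eq _ hfib (complexOrientationInt hX') (complexOrientationInt hX)
    hloc

/-- **Degree `+1` for the rational complex orientations**: `σ(ℂ)_* [X'(ℂ)]_ℚ = [X(ℂ)]_ℚ` for the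
`ℚ`-orientations `complexOrientationRat = complexOrientationInt ⊗ 1` (one good integral fibre and
`hasDegree_one_toCoeff_of_map_localClass_eq`). [cite: Fulton1998, Lemma 19.1.2 and §1.4]
[cite: HatcherAT2002, §3.3 p. 235 and Thm. 3.26] -/
theorem hasDegree_one_complexOrientationRat_of_isBirational (hX' : IsSmoothProjective n X')
    (hX : IsSmoothProjective n X) (σ : X' ⟶ X) (hσ : Resolution.IsBirational σ.left) :
    HasDegree (complexOrientationRat hX') (complexOrientationRat hX)
      (AlgPoints.mapContinuous (L := ℂ) σ) 1 := by
  letI := hX.chartedSpace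
  letI := hX'.chartedSpace
  haveI := ComplexPoints.compactSpace_of_isSmoothProjective hX
  haveI := ComplexPoints.compactSpace_of_isSmoothProjective hX'
  haveI := ComplexPoints.t2Space_of_isSmoothProjective hX
  haveI := ComplexPoints.t2Space_of_isSmoothProjective hX'
  haveI := connectedSpace_complexPoints hX
  obtain ⟨P, hfib, hloc⟩ := exists_map_localClass_complexOrientationInt_eq_of_isBirational hX' hX σ hσ
  exact hasDegree_one_toCoeff_of_map_localClass_eq _ hfib (complexOrientationInt hX')
    (complexOrientationInt hX) hloc

/-- **`σ(ℂ)_* [X'(ℂ)] = [X(ℂ)]` for the complex orientation FAMILY** (`ℂ`-coefficients): the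
fundamental classes of `complexOrientationFamily` are the complexified rational ones
(`fundamentalClass_complexOrientationFamily`), and change of coefficients commutes with push-forward.
[cite: Fulton1998, Lemma 19.1.2 and §1.4] [cite: VoisinHodgeI2002, §11.1.2] -/
theorem map_fundamentalClass_complexOrientationFamily_of_isBirational (hX' : IsSmoothProjective n X')
    (hX : IsSmoothProjective n X) (σ : X' ⟶ X) (hσ : Resolution.IsBirational σ.left) :
    singularHomology.map ℂ ℂ (AlgPoints.mapContinuous (L := ℂ) σ) (2 * n)
        (complexOrientationFamily hX').fundamentalClass =
      (complexOrientationFamily hX).fundamentalClass := by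
  have h := hasDegree_one_complexOrientationRat_of_isBirational hX' hX σ hσ
  rw [HasDegree, one_zsmul] at h
  rw [fundamentalClass_complexOrientationFamily, fundamentalClass_complexOrientationFamily,
    ← singularHomology.coeffChange_map, h]

/-- **`σ_* 1 = 1` for a birational morphism and the complex orientations**: the Gysin morphism
`complexGysin complexOrientationFamily` of a birational morphism `σ : X' ⟶ X` of smooth projective
`n`-folds sends `1 ∈ H⁰(X'(ℂ); ℂ)` to `1 ∈ H⁰(X(ℂ); ℂ)` — Fulton's Lemma 19.1.2 with
`deg(X'/X) = 1` on the tree's real carriers, the case `k = 1` (two smooth models of the same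
variety) of `Fulton1998_degreeFormula_complexOrientation`: `σ_* 1 ⌢ [X] = σ(ℂ)_* (1 ⌢ [X']) = σ(ℂ)_*[X'] = [X] = 1 ⌢ [X]`
and Poincaré duality. [cite: Fulton1998, Lemma 19.1.2 and §1.4] [cite: FultonYoungTableaux1997, Appendix B §B.1 (5)] -/
theorem complexGysin_complexOrientationFamily_one_of_isBirational (hX' : IsSmoothProjective n X')
    (hX : IsSmoothProjective n X) (σ : X' ⟶ X) (hσ : Resolution.IsBirational σ.left) :
    complexGysin complexOrientationFamily hX' hX σ (rfl : 0 + 2 * n = 0 + 2 * n)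
        (singularCohomology.one ℂ (ComplexPoints X')) =
      singularCohomology.one ℂ (ComplexPoints X) := by
  have hμ : complexOrientationFamily.HasPoincareDuality := hasPoincareDuality_complexOrientationFamily
  apply (hμ hX (show 0 + 2 * n = 2 * n by omega)).1
  rw [poincareDualityMap_apply, poincareDualityMap_apply,
    capProduct_complexGysin hμ hX' hX σ _ (show 0 + 2 * n = 2 * n by omega) (show 0 + 2 * n = 2 * n by omega),
    one_capProduct, one_capProduct, map_fundamentalClass_complexOrientationFamily_of_isBirational hX' hX σ hσ]

end HodgeTheory

end Literature.AlgebraicGeometry.HodgeTheory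

end
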